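import Literature.AlgebraicTopology.Homotopy.CollarPush
import Literature.AlgebraicTopology.SingularHomology.MayerVietorisExactness
import Literature.AlgebraicTopology.FundamentalGroup.SphereSimplyConnected
import Mathlib.Topology.Homotopy.Contractible
import HarnessLib

/-!
# The double of a collared space: Mayer–Vietoris and simple connectivity

Topic `Literature/AlgebraicTopology/Homotopy`. Elementary homotopy theory of a space `P` which is
the union of two closed embedded copies `jA(W)`, `jB(W)` of a space `W` carrying a boundary collar
`κ : A × [0, 1] → W` (`Literature.AlgebraicTopology.Homotopy.BoundaryCollar`, `CollarPush.lean`),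
the two copies meeting exactly along the bottom `κ (A × {0})` of the collar ("the boundary"):
`jA a = jB b ↔ a = b ∈ κ (A × {0})`. This is the topology of the *double* `D W = W ∪_{∂W} W` of a
compact manifold with boundary (Hirsch, *Differential Topology* (1976), §8.2; Munkres, *Elementary
Differential Topology* (1966), §6), recorded as the structure
`Literature.AlgebraicTopology.Homotopy.BoundaryCollar.DoubleData`; for a compact smooth manifold
with boundary the tree constructs such a `P` (`Literature.Topology.FourManifolds.exists_isBoundaryGluing_holds`,
`GluingProofs.lean`) and such a collar (`Literature.Topology.FourManifolds.NullCobordism.exists_boundaryCollar`).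

Everything here is proved; there are no named facts.

* `DoubleData.U t = P ∖ jB (core t)` and `DoubleData.V = P ∖ jA (W) = jB (interior)` form an open
  cover of `P` with `U t ∩ V = jB (strip t)` (`U_union_V`, `U_inter_V`, `V_eq`).
* **The squeeze** (`DoubleData.squeeze`): `jB (κ (a, r)) ↦ jB (κ (a, (1 - s) r))` on the `B`-collar,
  the identity elsewhere; jointly continuous on `[0, 1] × U t` (`continuousOn_squeeze`, pasting along
  the closed cover `range jA ∪ range jB`, the two formulas agreeing on the seam). At `s = 1` it
  retracts `U t` onto `jA (W)`, so `W ≅ jA (W) ↪ U t` is a homotopy equivalence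
  (`rangeHomotopyEquiv`, `homotopyEquivU`); `V ≅ interior ≃ W` (`interiorHomotopyEquiv` of
  `CollarPush.lean`) and `U t ∩ V ≅ strip t ≃ A` (`stripHomotopyEquiv`).
* **Homology of the double of a contractible space** (`nonempty_singularHomology_iso`): if `W` is
  contractible then the Mayer–Vietoris connecting map is an isomorphism
  `Hₖ₊₁(P; M) ≅ Hₖ(A; M)` for every `k ≥ 1` (Hatcher, *Algebraic Topology* (2002), §2.2, p. 149:
  the outer terms `Hⱼ(U) ⊕ Hⱼ(V)` vanish), from the tree's proved exactness of the Mayer–Vietoris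
  sequence (`mayerVietoris.exact₂_holds`, `exact₃_holds`) and proved excision
  (`relativeSingularHomology.isIso_map_of_interior_union_interior_holds`).
* **The double of a contractible space with path-connected boundary is simply connected**
  (`DoubleData.simplyConnectedSpace`; Hatcher 2002, Lemma 1.15, the tree's
  `simplyConnectedSpace_of_isOpen_cover`).

These are the book-keeping facts by which the boundary of a contractible compact manifold is shown to
be a homology sphere from Poincaré duality on the (closed) double, in Kervaire–Milnor's Lemma 2.3
(*Groups of homotopy spheres I*, Ann. of Math. 77 (1963), p. 506), see
`Literature/Topology/FourManifolds/NullCobordismDouble.lean`.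

## References

* A. Hatcher, *Algebraic Topology*, CUP (2002), Lemma 1.15, §2.2 (Mayer–Vietoris, p. 149),
  Prop. 3.42 (collars). [HatcherAT2002]
* M. W. Hirsch, *Differential Topology*, GTM 33, Springer (1976), §8.2 (the double). [Hirsch1976]
-/

noncomputable section

open Set Function Topology CategoryTheory CategoryTheory.Limits
open scoped unitInterval Topology ContinuousMap

universe u v

namespace Literature.AlgebraicTopology.Homotopy

/-! ### Path-connectedness is a homotopy invariant -/

/-- A space homotopy equivalent to a path-connected space is path connected: `y` is joined to
`e (e⁻¹ y)` along the homotopy `e ∘ e⁻¹ ≃ id`, and `e` carries paths of `X` to paths of `Y`. [folklore] -/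
theorem pathConnectedSpace_of_homotopyEquiv {X Y : Type*} [TopologicalSpace X] [TopologicalSpace Y]
    [PathConnectedSpace X] (e : X ≃ₕ Y) : PathConnectedSpace Y := by
  have key : ∀ y : Y, Joined (e.toFun (e.invFun y)) y := fun y =>
    ⟨e.right_inv.some.evalAt y⟩
  refine ⟨⟨e.toFun (Classical.arbitrary X)⟩, fun y y' => ?_⟩
  have hmid : Joined (e.toFun (e.invFun y)) (e.toFun (e.invFun y')) :=
    ⟨(PathConnectedSpace.somePath (e.invFun y) (e.invFun y')).map e.toFun.continuous⟩
  exact ((key y).symm.trans hmid).trans (key y')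

namespace BoundaryCollar

variable {W : Type u} [TopologicalSpace W] {A : Type u} [TopologicalSpace A]

/-- **Double data** for a collared space. For a boundary collar `κ : A × [0, 1] → W`, a space `P`
*is a double of `W` along the bottom of `κ`* if it carries two closed embeddings `jA, jB : W → P`
whose ranges cover `P` and which identify exactly the points of the bottom `κ (A × {0})` of the
collar: `jA a = jB b ↔ ∃ z, a = b = κ (z, 0)`. For a compact smooth manifold with boundary `W`,
`A = ∂W`, this is the topological content of the double `D W = W ∪_{id} W` (Hirsch 1976, §8.2;
the tree's `Literature.Topology.FourManifolds.IsDouble`). [cite: Hirsch1976, §8.2] -/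
structure DoubleData (κ : BoundaryCollar W A) (P : Type u) [TopologicalSpace P] where
  /-- The first copy of `W`. -/
  jA : W → P
  /-- The second copy of `W`. -/
  jB : W → P
  /-- The first copy is a closed embedding. -/
  isClosedEmbedding_jA : IsClosedEmbedding jA
  /-- The second copy is a closed embedding. -/
  isClosedEmbedding_jB : IsClosedEmbedding jB
  /-- The two copies cover `P`. -/
  range_union_range : range jA ∪ range jB = univ
  /-- The two copies meet exactly along the bottom of the collar, pointwise. -/
  jA_eq_jB_iff : ∀ a b, jA a = jB b ↔ ∃ z : A, a = κ.collar (z, 0) ∧ b = κ.collar (z, 0)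

namespace DoubleData

variable {κ : BoundaryCollar W A} {P : Type u} [TopologicalSpace P] (d : κ.DoubleData P)

attribute [local instance] Classical.propDecidable

/-! ### The seam -/

/-- On the bottom of the collar the two copies agree. [folklore] -/
theorem jA_seam (z : A) : d.jA (κ.collar (z, 0)) = d.jB (κ.collar (z, 0)) :=
  (d.jA_eq_jB_iff _ _).2 ⟨z, rfl, rfl⟩

/-- A point off the first copy lies on the second. [folklore] -/
theorem mem_range_jB_of_not_mem_range_jA {p : P} (h : p ∉ range d.jA) : p ∈ range d.jB := by
  have hp : p ∈ range d.jA ∪ range d.jB := by rw [d.range_union_range]; exact mem_univ p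
  exact hp.resolve_left h

/-- A point off the second copy lies on the first. [folklore] -/
theorem mem_range_jA_of_not_mem_range_jB {p : P} (h : p ∉ range d.jB) : p ∈ range d.jA := by
  have hp : p ∈ range d.jA ∪ range d.jB := by rw [d.range_union_range]; exact mem_univ p
  exact hp.resolve_right h

/-- A point of the second copy lies on the first copy iff it is a bottom point of the collar.
[folklore] -/
theorem jB_mem_range_jA_iff {b : W} :
    d.jB b ∈ range d.jA ↔ b ∈ range (fun z : A => κ.collar (z, 0)) := by
  constructor
  · rintro ⟨a, ha⟩
    obtain ⟨z, -, rfl⟩ := (d.jA_eq_jB_iff a b).1 ha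
    exact ⟨z, rfl⟩
  · rintro ⟨z, rfl⟩
    exact ⟨κ.collar (z, 0), d.jA_seam z⟩

/-- A point of the first copy lies on the second copy iff it is a bottom point of the collar.
[folklore] -/
theorem jA_mem_range_jB_iff {a : W} :
    d.jA a ∈ range d.jB ↔ a ∈ range (fun z : A => κ.collar (z, 0)) := by
  constructor
  · rintro ⟨b, hb⟩
    obtain ⟨z, rfl, -⟩ := (d.jA_eq_jB_iff a b).1 hb.symm
    exact ⟨z, rfl⟩
  · rintro ⟨z, rfl⟩
    exact ⟨κ.collar (z, 0), (d.jA_seam z).symm⟩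

/-! ### The open cover `U t`, `V` -/

/-- `V = P ∖ jA (W)`, the open complement of the first copy. [folklore] -/
def V : Set P := (range d.jA)ᶜ

/-- `V` is open. [folklore] -/
theorem isOpen_V : IsOpen d.V := d.isClosedEmbedding_jA.isClosed_range.isOpen_compl

/-- `V = jB (interior)`: the complement of the first copy is the second copy's interior. [folklore] -/
theorem V_eq : d.V = d.jB '' κ.interior := by
  ext p
  constructor
  · intro hp
    obtain ⟨b, rfl⟩ := d.mem_range_jB_of_not_mem_range_jA hp
    exact ⟨b, fun hb => hp (d.jB_mem_range_jA_iff.2 hb), rfl⟩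
  · rintro ⟨b, hb, rfl⟩ hmem
    exact hb (d.jB_mem_range_jA_iff.1 hmem)

/-- `U t = P ∖ jB (core t)`, the open complement of the second copy's core at level `t`: the first
copy together with the second copy's open collar below level `t`. [folklore] -/
def U (t : I) : Set P := (d.jB '' κ.core t)ᶜ

/-- `U t` is open (the core is closed and `jB` is a closed map). [folklore] -/
theorem isOpen_U (t : I) : IsOpen (d.U t) :=
  (d.isClosedEmbedding_jB.isClosedMap _ (κ.isClosed_core t)).isOpen_compl

/-- A point of the second copy lies in `U t` iff it lies below level `t`. [folklore] -/
theorem jB_mem_U_iff {b : W} {t : I} : d.jB b ∈ d.U t ↔ b ∈ κ.below t := by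
  rw [U, mem_compl_iff, d.isClosedEmbedding_jB.injective.mem_set_image, κ.mem_core_iff, not_not]

/-- For `t > 0` the first copy lies in `U t`. [folklore] -/
theorem range_jA_subset_U {t : I} (ht : 0 < t) : range d.jA ⊆ d.U t := by
  rintro _ ⟨a, rfl⟩ ⟨b, hb, hba⟩
  obtain ⟨z, rfl, rfl⟩ := (d.jA_eq_jB_iff a b).1 hba.symm
  exact not_lt.2 (κ.collar_mem_core_iff.1 hb) ht

/-- For `t > 0`, `U t` and `V` cover `P`. [folklore] -/
theorem U_union_V {t : I} (ht : 0 < t) : d.U t ∪ d.V = univ :=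
  eq_univ_of_forall fun p => by
    by_cases hp : p ∈ range d.jA
    · exact Or.inl (d.range_jA_subset_U ht hp)
    · exact Or.inr hp

/-- For `t > 0` the interiors of `U t` and `V` cover `P` (both are open). [folklore] -/
theorem interior_U_union_interior_V {t : I} (ht : 0 < t) :
    _root_.interior (d.U t) ∪ _root_.interior d.V = univ := by
  rw [(d.isOpen_U t).interior_eq, d.isOpen_V.interior_eq, d.U_union_V ht]

/-- `U t ∩ V = jB (strip t)`, the second copy's open strip between the boundary and level `t`.
[folklore] -/
theorem U_inter_V (t : I) : d.U t ∩ d.V = d.jB '' κ.strip t := by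
  ext p
  constructor
  · rintro ⟨hU, hV⟩
    rw [V_eq] at hV
    obtain ⟨b, hb, rfl⟩ := hV
    refine ⟨b, ?_, rfl⟩
    rw [κ.strip_eq]
    exact ⟨hb, d.jB_mem_U_iff.1 hU⟩
  · rintro ⟨b, hb, rfl⟩
    rw [κ.strip_eq] at hb
    refine ⟨d.jB_mem_U_iff.2 hb.2, ?_⟩
    rw [V_eq]
    exact ⟨b, hb.1, rfl⟩

/-! ### Homeomorphisms onto the pieces -/

/-- A subset of `W` is homeomorphic to its image in the second copy. [folklore] -/
def jBImageHomeomorph (s : Set W) : ↥s ≃ₜ ↥(d.jB '' s) :=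
  (d.isClosedEmbedding_jB.isEmbedding.comp IsEmbedding.subtypeVal).toHomeomorph.trans
    (Homeomorph.setCongr (by rw [range_comp, Subtype.range_coe]))

/-- The homeomorphism onto the image is `jB` on points. [folklore] -/
@[simp] theorem jBImageHomeomorph_apply_coe (s : Set W) (x : s) :
    (d.jBImageHomeomorph s x : P) = d.jB x := rfl

/-- `V ≅ interior`. [folklore] -/
def VHomeomorph : ↥κ.interior ≃ₜ ↥d.V :=
  (d.jBImageHomeomorph κ.interior).trans (Homeomorph.setCongr d.V_eq.symm)

/-- `U t ∩ V ≅ strip t`. [folklore] -/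
def UInterVHomeomorph (t : I) : ↥(κ.strip t) ≃ₜ ↥(d.U t ∩ d.V) :=
  (d.jBImageHomeomorph (κ.strip t)).trans (Homeomorph.setCongr (d.U_inter_V t).symm)

/-- `W ≅ jA (W)`. [folklore] -/
def jAHomeomorph : W ≃ₜ ↥(range d.jA) := d.isClosedEmbedding_jA.isEmbedding.toHomeomorph

variable [Nonempty A]

/-- **`V` is contractible when `W` is**: `V ≅ interior ≃ W` (`interiorHomotopyEquiv`, Hatcher 2002,
Prop. 3.42). [cite: HatcherAT2002, Prop. 3.42] -/
theorem contractibleSpace_V [ContractibleSpace W] {t : I} (ht : 0 < t) : ContractibleSpace ↥d.V :=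
  (d.VHomeomorph.symm.toHomotopyEquiv.trans (κ.interiorHomotopyEquiv ht)).contractibleSpace

/-! ### The squeeze of the second collar -/

/-- A total inverse of `jB` (junk off its range). [folklore] -/
def jBInv (p : P) : W :=
  if h : p ∈ range d.jB then d.isClosedEmbedding_jB.isEmbedding.toHomeomorph.symm ⟨p, h⟩
  else κ.collar (Classical.arbitrary A, 0)

/-- `jBInv ∘ jB = id`. [folklore] -/
@[simp] theorem jBInv_jB (b : W) : d.jBInv (d.jB b) = b := by
  rw [jBInv, dif_pos (mem_range_self b)]
  exact d.isClosedEmbedding_jB.isEmbedding.toHomeomorph_symm_apply b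

/-- `jBInv` is continuous on the range of `jB`. [folklore] -/
theorem continuousOn_jBInv : ContinuousOn d.jBInv (range d.jB) := by
  rw [continuousOn_iff_continuous_restrict]
  have h : (range d.jB).restrict d.jBInv = d.isClosedEmbedding_jB.isEmbedding.toHomeomorph.symm := by
    funext ⟨p, hp⟩
    simp only [restrict_apply, jBInv, dif_pos hp]
  rw [h]
  exact Homeomorph.continuous _

omit [Nonempty A] in
/-- The squeezed level `(1 - s) r`. [folklore] -/
def scale (s r : I) : I :=
  ⟨(unitInterval.symm s : ℝ) * r, unitInterval.mul_mem (unitInterval.symm s).2 r.2⟩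

omit [Nonempty A] in
/-- The squeezed level is jointly continuous. [folklore] -/
theorem continuous_scale : Continuous fun p : I × I => scale p.1 p.2 :=
  Continuous.subtype_mk ((continuous_subtype_val.comp
    (unitInterval.continuous_symm.comp continuous_fst)).mul
    (continuous_subtype_val.comp continuous_snd)) _

omit [Nonempty A] in
/-- No squeeze at `s = 0`. [folklore] -/
@[simp] theorem scale_zero_left (r : I) : scale 0 r = r := Subtype.ext (by simp [scale])

omit [Nonempty A] in
/-- Full squeeze at `s = 1`. [folklore] -/
@[simp] theorem scale_one_left (r : I) : scale 1 r = 0 := Subtype.ext (by simp [scale])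

omit [Nonempty A] in
/-- The bottom level is fixed. [folklore] -/
@[simp] theorem scale_zero_right (s : I) : scale s 0 = 0 := Subtype.ext (by simp [scale])

omit [Nonempty A] in
/-- Squeezing does not raise the level. [folklore] -/
theorem scale_le (s r : I) : scale s r ≤ r :=
  Subtype.coe_le_coe.1 (mul_le_of_le_one_left r.2.1 (unitInterval.symm s).2.2)

/-- **The squeeze**: `jB (κ (a, r)) ↦ jB (κ (a, (1 - s) r))` on the second copy, the identity off it
(meaningful on `U t`, where the second copy is met only below level `t`). [folklore] -/
def squeeze (s : I) (p : P) : P :=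
  if p ∈ range d.jB then
    d.jB (κ.collar ((κ.inv (d.jBInv p)).1, scale s (κ.inv (d.jBInv p)).2))
  else p

/-- The squeeze on the second collar. [folklore] -/
@[simp] theorem squeeze_jB_collar (s : I) (q : A × I) :
    d.squeeze s (d.jB (κ.collar q)) = d.jB (κ.collar (q.1, scale s q.2)) := by
  rw [squeeze, if_pos (mem_range_self _), jBInv_jB, κ.inv_collar]

/-- The squeeze off the second copy is the identity. [folklore] -/
theorem squeeze_of_not_mem (s : I) {p : P} (hp : p ∉ range d.jB) : d.squeeze s p = p := if_neg hp

/-- The squeeze fixes the first copy (on the seam the level is `0`). [folklore] -/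
theorem squeeze_of_mem_range_jA (s : I) {p : P} (hp : p ∈ range d.jA) : d.squeeze s p = p := by
  by_cases hB : p ∈ range d.jB
  · obtain ⟨b, rfl⟩ := hB
    obtain ⟨z, rfl⟩ := d.jB_mem_range_jA_iff.1 hp
    rw [squeeze_jB_collar, scale_zero_right]
  · exact d.squeeze_of_not_mem s hB

/-- At `s = 0` the squeeze is the identity on `U t`. [folklore] -/
theorem squeeze_zero {t : I} {p : P} (hp : p ∈ d.U t) : d.squeeze 0 p = p := by
  by_cases hB : p ∈ range d.jB
  · obtain ⟨b, rfl⟩ := hB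
    obtain ⟨q, -, rfl⟩ := d.jB_mem_U_iff.1 hp
    rw [squeeze_jB_collar, scale_zero_left]
  · exact d.squeeze_of_not_mem 0 hB

/-- The squeeze preserves `U t`. [folklore] -/
theorem squeeze_mapsTo (s t : I) : MapsTo (d.squeeze s) (d.U t) (d.U t) := by
  intro p hp
  by_cases hB : p ∈ range d.jB
  · obtain ⟨b, rfl⟩ := hB
    obtain ⟨q, hq, rfl⟩ := d.jB_mem_U_iff.1 hp
    rw [squeeze_jB_collar, jB_mem_U_iff, collar_mem_below_iff]
    exact lt_of_le_of_lt (scale_le s q.2) hq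
  · rw [d.squeeze_of_not_mem s hB]
    exact hp

/-- At `s = 1` the squeeze retracts `U t` onto the first copy. [folklore] -/
theorem squeeze_one_mem {t : I} {p : P} (hp : p ∈ d.U t) : d.squeeze 1 p ∈ range d.jA := by
  by_cases hB : p ∈ range d.jB
  · obtain ⟨b, rfl⟩ := hB
    obtain ⟨q, -, rfl⟩ := d.jB_mem_U_iff.1 hp
    rw [squeeze_jB_collar, scale_one_left]
    exact ⟨κ.collar (q.1, 0), d.jA_seam q.1⟩
  · rw [d.squeeze_of_not_mem 1 hB]
    exact d.mem_range_jA_of_not_mem_range_jB hB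

/-- **The squeeze is jointly continuous on `[0, 1] × U t`**: pasting along the closed cover of `P` by
`range jA` and `range jB`, on whose intersection (the seam, level `0`) both formulas are the
identity; on `U t` the second copy is met inside the collar, where `κ⁻¹` is continuous. [folklore] -/
theorem continuousOn_squeeze (t : I) :
    ContinuousOn (fun q : I × P => d.squeeze q.1 q.2) (univ ×ˢ d.U t) := by
  have hS : IsClosed {q : I × P | q.2 ∈ range d.jB} :=
    d.isClosedEmbedding_jB.isClosed_range.preimage continuous_snd
  have hT : IsClosed {q : I × P | q.2 ∈ range d.jA} :=
    d.isClosedEmbedding_jA.isClosed_range.preimage continuous_snd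
  change ContinuousOn (fun q : I × P => if q.2 ∈ range d.jB then
    d.jB (κ.collar ((κ.inv (d.jBInv q.2)).1, scale q.1 (κ.inv (d.jBInv q.2)).2)) else q.2) _
  refine ContinuousOn.if ?_ ?_ ?_
  · rintro ⟨s, p⟩ ⟨-, hfr⟩
    have hpB : p ∈ range d.jB := by
      have h := frontier_subset_closure hfr
      rwa [hS.closure_eq] at h
    have hpA : p ∈ range d.jA := by
      have h1 : ((s, p) : I × P) ∈ closure {q : I × P | q.2 ∈ range d.jB}ᶜ := by
        rw [frontier_eq_closure_inter_closure] at hfr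
        exact hfr.2
      have hsub : {q : I × P | q.2 ∈ range d.jB}ᶜ ⊆ {q : I × P | q.2 ∈ range d.jA} :=
        fun q hq => d.mem_range_jA_of_not_mem_range_jB hq
      exact (hT.closure_subset_iff.2 hsub) h1
    obtain ⟨b, rfl⟩ := hpB
    obtain ⟨z, rfl⟩ := d.jB_mem_range_jA_iff.1 hpA
    show d.jB (κ.collar _) = d.jB (κ.collar (z, 0))
    rw [jBInv_jB, κ.inv_collar, scale_zero_right]
  · rw [hS.closure_eq]
    have hmaps : MapsTo (fun q : I × P => d.jBInv q.2)
        ((univ ×ˢ d.U t) ∩ {q : I × P | q.2 ∈ range d.jB}) (range κ.collar) := by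
      rintro ⟨s, p⟩ ⟨⟨-, hU⟩, hB⟩
      obtain ⟨b, hb⟩ := hB
      subst hb
      show d.jBInv (d.jB b) ∈ range κ.collar
      rw [jBInv_jB]
      exact κ.below_subset_range t (d.jB_mem_U_iff.1 hU)
    have h1 : ContinuousOn (fun q : I × P => d.jBInv q.2)
        ((univ ×ˢ d.U t) ∩ {q : I × P | q.2 ∈ range d.jB}) :=
      d.continuousOn_jBInv.comp continuous_snd.continuousOn fun q hq => hq.2
    have h2 : ContinuousOn (fun q : I × P => κ.inv (d.jBInv q.2))
        ((univ ×ˢ d.U t) ∩ {q : I × P | q.2 ∈ range d.jB}) :=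
      κ.continuousOn_inv.comp h1 hmaps
    have hF : Continuous fun r : I × (A × I) => d.jB (κ.collar (r.2.1, scale r.1 r.2.2)) :=
      d.isClosedEmbedding_jB.continuous.comp (κ.continuous.comp
        ((continuous_fst.comp continuous_snd).prodMk
          (continuous_scale.comp (continuous_fst.prodMk (continuous_snd.comp continuous_snd)))))
    exact hF.comp_continuousOn (continuous_fst.continuousOn.prodMk h2)
  · exact continuous_snd.continuousOn

/-- The squeeze as a jointly continuous self-map of `U t` over `[0, 1]`. [folklore] -/
def squeezeMap (t : I) : C(I × ↥(d.U t), ↥(d.U t)) where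
  toFun q := ⟨d.squeeze q.1 q.2, d.squeeze_mapsTo q.1 t q.2.2⟩
  continuous_toFun :=
    ((d.continuousOn_squeeze t).comp_continuous
      (continuous_fst.prodMk (continuous_subtype_val.comp continuous_snd))
      fun q => ⟨mem_univ _, q.2.2⟩).subtype_mk _

/-- The squeeze self-map on points. [folklore] -/
@[simp] theorem squeezeMap_apply_coe (t : I) (q : I × ↥(d.U t)) :
    (d.squeezeMap t q : P) = d.squeeze q.1 q.2 := rfl

/-- **The first copy is a deformation retract of `U t`** (`t > 0`): the inclusion `jA (W) ↪ U t` is a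
homotopy equivalence with inverse the full squeeze `squeeze 1`, the squeezes `squeeze (1 - s)`
deforming it to the identity (Hatcher 2002, Ch. 0, deformation retractions). [cite: HatcherAT2002, Ch. 0 (deformation retraction)] -/
def rangeHomotopyEquiv {t : I} (ht : 0 < t) : (↥(range d.jA)) ≃ₕ ↥(d.U t) where
  toFun := ⟨Set.inclusion (d.range_jA_subset_U ht), continuous_inclusion _⟩
  invFun := ⟨fun p => ⟨d.squeeze 1 p, d.squeeze_one_mem p.2⟩,
    (continuous_subtype_val.comp ((d.squeezeMap t).continuous.comp
      (Continuous.prodMk_right (1 : I)))).subtype_mk _⟩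
  left_inv := by
    have h : (⟨fun p => ⟨d.squeeze 1 p, d.squeeze_one_mem p.2⟩,
        (continuous_subtype_val.comp ((d.squeezeMap t).continuous.comp
          (Continuous.prodMk_right (1 : I)))).subtype_mk _⟩ : C(↥(d.U t), ↥(range d.jA))).comp
        ⟨Set.inclusion (d.range_jA_subset_U ht), continuous_inclusion _⟩ =
        ContinuousMap.id _ := by
      ext p
      exact d.squeeze_of_mem_range_jA 1 p.2
    rw [h]
  right_inv :=
    ⟨{ toFun := fun q => d.squeezeMap t (unitInterval.symm q.1, q.2)
       continuous_toFun := (d.squeezeMap t).continuous.comp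
         ((unitInterval.continuous_symm.comp continuous_fst).prodMk continuous_snd)
       map_zero_left := fun p => Subtype.ext (by simp)
       map_one_left := fun p => Subtype.ext (by simpa using d.squeeze_zero p.2) }⟩

/-- **`W ≃ U t`** for `t > 0`: `W ≅ jA (W) ↪ U t`. [cite: HatcherAT2002, Ch. 0 (deformation retraction)] -/
def homotopyEquivU {t : I} (ht : 0 < t) : W ≃ₕ ↥(d.U t) :=
  d.jAHomeomorph.toHomotopyEquiv.trans (d.rangeHomotopyEquiv ht)

/-- The forward map of `homotopyEquivU` is `jA`. [folklore] -/
@[simp] theorem homotopyEquivU_apply_coe {t : I} (ht : 0 < t) (w : W) :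
    (d.homotopyEquivU ht w : P) = d.jA w := rfl

/-- **`U t` is contractible when `W` is** (`t > 0`). [folklore] -/
theorem contractibleSpace_U [ContractibleSpace W] {t : I} (ht : 0 < t) :
    ContractibleSpace ↥(d.U t) :=
  (d.homotopyEquivU ht).symm.contractibleSpace

/-! ### Homology of the double of a contractible space -/

section Homology

open Literature.AlgebraicTopology.SingularHomology

variable (R : Type v) [CommRing R] (M : Type v) [AddCommGroup M] [Module R M]

/-- `Hₖ(U t; M) = 0` for `k ≥ 1` when `W` is contractible. [folklore] -/
theorem isZero_singularHomology_U [ContractibleSpace W] {t : I} (ht : 0 < t) {k : ℕ} (hk : k ≠ 0) :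
    IsZero (singularHomology R M ↥(d.U t) k) := by
  haveI := d.contractibleSpace_U ht
  exact isZero_singularHomology_of_contractibleSpace R M hk

/-- `Hₖ(V; M) = 0` for `k ≥ 1` when `W` is contractible. [folklore] -/
theorem isZero_singularHomology_V [ContractibleSpace W] {t : I} (ht : 0 < t) {k : ℕ} (hk : k ≠ 0) :
    IsZero (singularHomology R M ↥d.V k) := by
  haveI := d.contractibleSpace_V ht
  exact isZero_singularHomology_of_contractibleSpace R M hk

/-- `Hₖ(A; M) ≅ Hₖ(U t ∩ V; M)` along the slice `a ↦ jB (κ (a, u))`, `0 < u < t`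
(`stripHomotopyEquiv`). [folklore] -/
def singularHomologyInterIso {u t : I} (hu : 0 < u) (hut : u < t) (k : ℕ) :
    singularHomology R M A k ≅ singularHomology R M ↥(d.U t ∩ d.V) k :=
  singularHomology.isoOfHomotopyEquiv R M
    ((κ.stripHomotopyEquiv hu hut).trans (d.UInterVHomeomorph t).toHomotopyEquiv) k

/-- **The Mayer–Vietoris connecting map `δ : Hₖ₊₁(P) → Hₖ(U t ∩ V)` of the double of a contractible
space is an isomorphism for `k ≥ 1`**: in
`Hₖ₊₁(U) ⊕ Hₖ₊₁(V) → Hₖ₊₁(P) →δ Hₖ(U ∩ V) → Hₖ(U) ⊕ Hₖ(V)` the outer terms vanish (Hatcher 2002,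
§2.2, p. 149; exactness `mayerVietoris.exact₂_holds`, `exact₃_holds`, excision
`relativeSingularHomology.isIso_map_of_interior_union_interior_holds`). [cite: HatcherAT2002, §2.2 p. 149] -/
theorem isIso_mayerVietoris_δ [ContractibleSpace W] {t : I} (ht : 0 < t) {k : ℕ} (hk : k ≠ 0) :
    IsIso (mayerVietoris.δ R M (d.U t) d.V
      (relativeSingularHomology.isIso_map_of_interior_union_interior_holds R M P)
      (d.interior_U_union_interior_V ht) k) := by
  have hexc := relativeSingularHomology.isIso_map_of_interior_union_interior_holds R M P
  have hUV := d.interior_U_union_interior_V ht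
  have hψ : mayerVietoris.ψ R M (d.U t) d.V (k + 1) = 0 := by
    refine biprod.hom_ext' _ _ ?_ ?_
    · exact (d.isZero_singularHomology_U R M ht k.succ_ne_zero).eq_of_src _ _
    · exact (d.isZero_singularHomology_V R M ht k.succ_ne_zero).eq_of_src _ _
  haveI : Mono (mayerVietoris.δ R M (d.U t) d.V hexc hUV k) :=
    (mayerVietoris.exact₂_holds R M (d.U t) d.V hexc hUV k).mono_g hψ
  have hφ : mayerVietoris.φ R M (d.U t) d.V k = 0 := by
    refine biprod.hom_ext _ _ ?_ ?_
    · exact (d.isZero_singularHomology_U R M ht hk).eq_of_tgt _ _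
    · exact (d.isZero_singularHomology_V R M ht hk).eq_of_tgt _ _
  haveI : Epi (mayerVietoris.δ R M (d.U t) d.V hexc hUV k) :=
    (mayerVietoris.exact₃_holds R M (d.U t) d.V hexc hUV k).epi_f hφ
  exact isIso_of_mono_of_epi _

omit [Nonempty A] in
/-- A level strictly between `0` and `t > 0`. [folklore] -/
theorem exists_level_between {t : I} (ht : 0 < t) : ∃ u : I, 0 < u ∧ u < t := by
  have ht' : (0 : ℝ) < t := ht
  refine ⟨⟨(t : ℝ) / 2, ?_⟩, ?_, ?_⟩
  · constructor <;> linarith [t.2.2]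
  · show (0 : ℝ) < t / 2
    linarith
  · show (t : ℝ) / 2 < t
    linarith

include d in
/-- **Homology of the double of a contractible collared space**: `Hₖ₊₁(P; M) ≅ Hₖ(A; M)` for every
`k ≥ 1`, where `A` parametrises the collar ("the boundary") (Mayer–Vietoris, Hatcher 2002, §2.2,
p. 149). For `P = D W'` the double of a compact contractible manifold with boundary `M`:
`Hₖ₊₁(D W') ≅ Hₖ(M)`. [cite: HatcherAT2002, §2.2 p. 149] -/
theorem nonempty_singularHomology_iso [ContractibleSpace W] {t : I} (ht : 0 < t) {k : ℕ}
    (hk : k ≠ 0) : Nonempty (singularHomology R M P (k + 1) ≅ singularHomology R M A k) := by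
  obtain ⟨u, hu, hut⟩ := exists_level_between ht
  haveI := d.isIso_mayerVietoris_δ R M ht hk
  exact ⟨asIso (mayerVietoris.δ R M (d.U t) d.V
      (relativeSingularHomology.isIso_map_of_interior_union_interior_holds R M P)
      (d.interior_U_union_interior_V ht) k) ≪≫ (d.singularHomologyInterIso R M hu hut k).symm⟩

end Homology

/-! ### Simple connectivity of the double -/

/-- `U t ∩ V` is path connected when `A` is (`U t ∩ V ≅ strip t ≃ A`). [folklore] -/
theorem isPathConnected_U_inter_V [PathConnectedSpace A] {t : I} (ht : 0 < t) :
    IsPathConnected (d.U t ∩ d.V) := by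
  obtain ⟨u, hu, hut⟩ := exists_level_between ht
  haveI : PathConnectedSpace ↥(d.U t ∩ d.V) :=
    pathConnectedSpace_of_homotopyEquiv
      ((κ.stripHomotopyEquiv hu hut).trans (d.UInterVHomeomorph t).toHomotopyEquiv)
  exact isPathConnected_iff_pathConnectedSpace.2 this

include d in
/-- **The double of a contractible collared space with path-connected boundary is simply connected**
(van Kampen with trivial groups, Hatcher 2002, Lemma 1.15, for the open cover `U t`, `V` by
contractible sets meeting in the path-connected `U t ∩ V ≃ A`). [cite: HatcherAT2002, Lemma 1.15] -/
theorem simplyConnectedSpace [ContractibleSpace W] [PathConnectedSpace A] {t : I} (ht : 0 < t) :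
    SimplyConnectedSpace P := by
  haveI := d.contractibleSpace_U ht
  haveI := d.contractibleSpace_V ht
  have hmeet := d.isPathConnected_U_inter_V ht
  obtain ⟨x₀, hxU, hxV⟩ := hmeet.nonempty
  have hU : IsSimplyConnected (d.U t) := (inferInstance : _root_.SimplyConnectedSpace ↥(d.U t))
  have hV : IsSimplyConnected d.V := (inferInstance : _root_.SimplyConnectedSpace ↥d.V)
  refine Literature.AlgebraicTopology.FundamentalGroup.simplyConnectedSpace_of_isOpen_cover (c := fun b : Bool => cond b (d.U t) d.V)
    (fun b => ?_) ?_ (fun b => ?_) (fun b b' => ?_) (x₀ := x₀) (fun b => ?_)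
  · cases b
    · exact d.isOpen_V
    · exact d.isOpen_U t
  · rw [← d.U_union_V ht, union_eq_iUnion]
  · cases b
    · exact hV
    · exact hU
  · cases b <;> cases b'
    · simpa using hV.isPathConnected
    · simpa [inter_comm] using hmeet
    · simpa using hmeet
    · simpa using hU.isPathConnected
  · cases b
    · exact hxV
    · exact hxU

end DoubleData

end BoundaryCollar

end Literature.AlgebraicTopology.Homotopy

end
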